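import Summits.PneNP.PneNP.Theorems.ReslinSizeFromWidthPCDegree
import Summits.PneNP.PneNP.Theorems.ReslinSizeFromWidthTreeLike
import Summits.PneNP.PneNP.Theorems.ReslinSizeFromWidthQuadratic
import Summits.PneNP.PneNP.Theorems.ReslinSizeFromWidthClauseSpace
import HarnessLib

/-!
# PneNP / ReslinSizeFromWidth — consequences of a PC/`𝔽₂` degree lower bound for Res(⊕)

Helper file for crux `ResLinSizeFromWidth` (stmt-PneNP-18932): the INPUT side of the laws already
in the tree.  `ReslinSizeFromWidthPCDegree.lean` shows that a PC/`𝔽₂` degree lower bound `d` for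
the clause polynomials of a CNF `φ` of clause width `≤ t ≤ d` forces rank-width `≥ d` on every
Res(⊕) refutation of `φ` (`resLin_rank_of_pcDegree`).  Feeding this into the three laws of the
ladder gives, for such `φ`:

* tree-like size (gen-3 law `ResLinSW.pow_le_length_of_treeLike`): every TREE-LIKE Res(⊕)
  refutation has at least `2^(d - t - 1)` lines (`treeLike_length_of_pcDegree`) — the route by
  which Garlík–Kołodziejczyk and Efremenko–Garlík–Itsykson (§1.1.1: "degree lower bounds for random
  3-CNFs [AR01] and the functional graph pigeonhole principle [MN15] imply exponential lower bounds on
  the size of tree-like Res(⊕) proofs") obtain tree-like Res(⊕) lower bounds;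
* clause space (gen-4 law `resLinClauseSpace_of_rank`, Gryaznov–Ovcharov–Riazanov Thm 6): every
  configuration-style Res(⊕) refutation has clause space `≥ d + 1 - t`
  (`clauseSpace_of_pcDegree`) — GOR's Corollary 1 "Space(φ) ≥ Deg(φ) − r − 1", here with the
  tree's constants;
* dag-like size (gen-2 quadratic law `ResLinSW.quadratic_le_length_of_isResLinRefutation`): every
  Res(⊕) refutation `π` satisfies `2 + (d-1)·d ≤ 2|π| + t(t+1)` (`quadratic_length_of_pcDegree`).

All three are unconditional theorems about the tree's Res(⊕) (semantic weakening); the PC degree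
lower bound enters as the hypothesis `¬ PC.RefutableInDegree (cnfPolys (ZMod 2) φ) d` on
Krajíček's translation, to be discharged by PC/`𝔽₂` degree facts (e.g. for graph ordering /
functional pigeonhole principles, Galesi–Lauria 2010 and Mikša–Nordström 2015, not in the tree).

References: S. Gryaznov, S. Ovcharov, A. Riazanov, ACM ToCT (2024), arXiv:2404.08370, Thm 6–7 and
Cor. 1; K. Efremenko, M. Garlík, D. Itsykson, STOC 2024, §1.1.1; M. Garlík, L. A. Kołodziejczyk,
ACM ToCL 19(4) (2018), §8.
-/

namespace Summit.PneNP.PneNP.Theorems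

-- `Summit.PneNP.PneNP` repeats a path component by design (summit = sub-problem); silence the linter.
set_option linter.dupNamespace false

open Literature.Computability.Complexity Literature.Computability.MetaComplexity
open Summit.PneNP.PneNP.Theorems.PolyCalc

/-- **Tree-like Res(⊕) size from PC/`𝔽₂` degree.**  If the clause polynomials of a CNF `φ` of
clause width `≤ t ≤ d` have no PC/`𝔽₂` refutation of degree `≤ d`, then every tree-like Res(⊕)
refutation of `φ` (every line used as a premise at most once) has at least `2^(d - t - 1)` lines.
[Efremenko–Garlík–Itsykson 2024, §1.1.1 (the method); gen-3 law `ResLinSW.pow_le_length_of_treeLike`] -/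
theorem treeLike_length_of_pcDegree {φ : CNF ℕ} {t d : ℕ} (hφ : φ.IsWidthLE t) (htd : t ≤ d)
    (hdeg : ¬ PC.RefutableInDegree (cnfPolys (ZMod 2) φ) d) {π : List ResLinLine}
    (hπ : IsResLinRefutation φ π) (htree : ∀ i : ℕ, (π.map fun l => l.premises.count i).sum ≤ 1) :
    2 ^ (d - t - 1) ≤ π.length :=
  ResLinSW.pow_le_length_of_treeLike hφ
    (fun _ hπ' => resLin_rank_of_pcDegree (fun c hc => (hφ c hc).trans htd) hdeg hπ') hπ htree

/-- **Res(⊕) clause space from PC/`𝔽₂` degree** (Gryaznov–Ovcharov–Riazanov, Cor. 1, in the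
tree's constants).  If the clause polynomials of a CNF `φ` of clause width `≤ t < d` have no
PC/`𝔽₂` refutation of degree `≤ d`, then every configuration-style Res(⊕) refutation of `φ` has
clause space at least `d + 1 - t`. [Gryaznov–Ovcharov–Riazanov 2024, Cor. 1 with Thm 6;
gen-4 law `resLinClauseSpace_of_rank`] -/
theorem clauseSpace_of_pcDegree {φ : CNF ℕ} {t d : ℕ} (hφ : φ.IsWidthLE t) (htd : t + 1 ≤ d)
    (hdeg : ¬ PC.RefutableInDegree (cnfPolys (ZMod 2) φ) d) {ϖ : List (Finset LinClause)}
    (hϖ : IsResLinSpaceRefutation φ ϖ) : d + 1 - t ≤ resLinClauseSpace ϖ := by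
  have hrank : ∀ π : List ResLinLine, IsResLinRefutation φ π → d - 1 < resLinWidth π := by
    intro π hπ
    have := resLin_rank_of_pcDegree (fun c hc => (hφ c hc).trans (by omega)) hdeg hπ
    omega
  have h := resLinClauseSpace_of_rank hφ (by omega) hrank hϖ
  have heq : d - 1 + 2 - t = d + 1 - t := by omega
  rwa [heq] at h

/-- **Dag-like Res(⊕) size from PC/`𝔽₂` degree, quadratic law.**  If the clause polynomials of a
CNF `φ` of clause width `≤ t < d` have no PC/`𝔽₂` refutation of degree `≤ d`, then every Res(⊕)
refutation `π` of `φ` satisfies `2 + (d - 1)·d ≤ 2·|π| + t·(t + 1)`, i.e. has `Ω(d²)` lines.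
[gen-2 law `ResLinSW.quadratic_le_length_of_isResLinRefutation`] -/
theorem quadratic_length_of_pcDegree {φ : CNF ℕ} {t d : ℕ} (hφ : φ.IsWidthLE t) (htd : t + 1 ≤ d)
    (hdeg : ¬ PC.RefutableInDegree (cnfPolys (ZMod 2) φ) d) {π : List ResLinLine}
    (hπ : IsResLinRefutation φ π) : 2 + (d - 1) * d ≤ 2 * π.length + t * (t + 1) :=
  ResLinSW.quadratic_le_length_of_isResLinRefutation hφ
    (fun _ hπ' => resLin_rank_of_pcDegree (fun c hc => (hφ c hc).trans (by omega)) hdeg hπ') htd hπ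

end Summit.PneNP.PneNP.Theorems
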